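/-
Copyright (c) 2026 the pub-hodgecm-mathlib formalisation cell (harness21).  Prover seat hodgecm-mathlib-LH4-p04 (g2), req620 Track A «(D-RAM) FOUR-FRAME» squad
(MS ROAD A, STAGE B brick B3 of LH4-p10 (g2) `SPEC-StageB.v1` §B ∕ B10 skeleton v1 — part 4: THE SHAPE LIST in axis currency (B3-γ, stub `stub_B3_shapes`)).  2026-09-04.
-/
import Summits.HodgeConjecture.HodgeConjecture.Theorems.F0P3cDyRamDiagonalDualisableStrata      -- part 2 (this seat): `dualisable_strata` (the HNF table); brings part 1, ★ TorusDefs, ★ HNF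
import Summits.HodgeConjecture.HodgeConjecture.Theorems.F0P3cDyRamDiagonalStrataAxis            -- part 3 (this seat): `hasAxis_unique`; brings ★ StrataDefs (`HasAxis`), ★ `IsRamifiedQuadraticDatum`
import Summits.HodgeConjecture.HodgeConjecture.Theorems.F0P3cDyRamDiagonalHNFAxisExponents     -- ★ B2 p855755 (LH4-p08): `single_{zero,one,two}_mem_latt_hnf_pow_iff`
import Summits.HodgeConjecture.HodgeConjecture.Theorems.F0P3cDyRamDiagonalStableLatticeHNFExists -- ★ p855304 (LH4-p08): `exists_latt_eq_latt_hnf`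
import HarnessLib

/-!
# Crux `H413`, line LH4 «(D-RAM) FOUR-FRAME» road — unit U3_Laws (iii), MS ROAD A, STAGE B brick B3 (part 4): THE SHAPE LIST — the axis vector of a dualisable normalised
# `T`-stable lattice is `(0,0,0)`, `(0,s,s)∕(s,0,s)∕(s,s,0)` (`s ≥ 2` even), `(2ρ, 2ρ+s, 2ρ+s)` and its two rotations (`ρ ≥ 1`, `s ≥ 2` even), or `(2ρ, 2ρ, 2ρ)` (`ρ ≥ 1`)

Cell `hodgecm-mathlib` (D-0151), FLOOR 0, crux item H413 = `stmt-HodgeConjecture-24833`, route of record `HCCMUnconditional`; squad F0∕P3c∕LH4 (req618∕req620); registered stub served: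
`F0P3cDyRamFourFrameU3.stub_U3_stableModelSum` (MS).  THEOREMS ONLY (no `def`, no instance, no notation, no `sorry`, default heartbeats); lane
`--supports stmt-HodgeConjecture-24833 --as helper` (count-neutral).  This is the B10 skeleton stub `stub_B3_shapes` (LH4-p10 (g2) `B10-StableCountTypeZero.SKELETON.v1`
c61f53438acbd4dd) in the axis currency of ★ `F0P3cDyRamDiagonalStrataDefs` (`HasAxis ϖ M a := ∀ i t, t·eᵢ ∈ M ↔ |t| ≤ |ϖ|^{aᵢ}`).

THE MATHEMATICS (LH4-p10 MEMO v2 §1, (3.1)).  A normalised lattice `latt g ⊆ 𝒪³` has an HNF model `V = (1 0 0; x ϖ^b 0; y z ϖ^c)` (★ `exists_latt_eq_latt_hnf`); if it is dualisable,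
part 2 (`dualisable_strata`) places `(b, c, x, y, z)` in one of the eight strata core∕T₃∕T₂∕T₁∕G₁∕G₂∕G₃∕H; on each stratum the three axis criteria of ★ B2
(`t·e₂ ∈ latt V ↔ |t| ≤ |ϖ|^c`, `t·e₁ ∈ latt V ↔ |t| ≤ |ϖ|^b ∧ |tz| ≤ |ϖ|^{b+c}`, `t·e₀ ∈ latt V ↔ |t| ≤ 1 ∧ |tx| ≤ |ϖ|^b ∧ |t(yϖ^b − xz)| ≤ |ϖ|^{b+c}`) collapse to
`|t| ≤ |ϖ|^{aᵢ}` with the axis vectors (§2) core `(0,0,0)`, T₃ `(s,s,0)`, T₂ `(s,0,s)`, T₁ `(0,s,s)`, G₁ `(2ρ, 2ρ+s, 2ρ+s)`, G₂ `(2ρ+s, 2ρ, 2ρ+s)`, G₃ `(2ρ+s, 2ρ+s, 2ρ)`,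
H `(2ρ, 2ρ, 2ρ)`; by uniqueness of the axis vector (part 3 `hasAxis_unique`) these are the only axis vectors of dualisable members of `𝓛₀(T)` (§3).

WHAT IS PROVED.  §1 three order lemmas in `ℤᵐ⁰` (`mul_exp_le_exp_iff`, `le_and_mul_exp_le_iff`, `le_and_le_and_mul_exp_le_iff`).  §2 the eight axis vectors `hasAxis_latt_hnf_core∕_T3∕_T2∕
_T1∕_G1∕_G2∕_G3∕_H`.  §3 HEAD `hasAxis_shapes` (= `stub_B3_shapes`: for `M ∈ normalisedStableLattices T` dualisable with `HasAxis ϖ M a`, under the ramified quadratic datum: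
`a = (0,0,0)` ∨ `∃ s, 2∣s ∧ 2 ≤ s ∧ a ∈ {(0,s,s),(s,0,s),(s,s,0)}` ∨ `∃ ρ s, 1 ≤ ρ ∧ 2∣s ∧ 2 ≤ s ∧ a ∈ {(2ρ,2ρ+s,2ρ+s), (2ρ+s,2ρ,2ρ+s), (2ρ+s,2ρ+s,2ρ)}` ∨ `∃ ρ, 1 ≤ ρ ∧ a = (2ρ,2ρ,2ρ)`).
HONEST LABEL.  Count-neutral (`--supports`); nothing printed is asserted; (MS) stays a PROVER TARGET (empirical census law — MEMO v2 is its paper proof, oracle-checked class by class);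
`HC_CM` is proved only modulo the 7 printed citations (2 remaining named inputs: hLiu418 = `stmt-HodgeConjecture-24832`, h413 = `stmt-HodgeConjecture-24833`) until rung 0 closes.

## References
* [Kottwitz1986BaseChangeUnits] R. E. Kottwitz, *Base change for unit elements of Hecke algebras*, Compositio Math. 60 (1986), §1 pp. 240–241 (fixed lattices counted by position).
* [Serre1980Trees] J.-P. Serre, *Trees*, Springer (1980), Ch. II §1.1 (lattices, Hermite normal forms, coordinate axes).
* [BruhatTits1972] F. Bruhat, J. Tits, *Groupes réductifs sur un corps local I*, Publ. Math. IHÉS 41 (1972), §10 (apartments: distance to the splitting sub-buildings).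
-/

set_option autoImplicit false

noncomputable section

namespace Summit.HodgeConjecture.HodgeConjecture.Cruxes.H413.F0P3cDyRamDiagonalStrataShapes

open Matrix
open Literature.NumberTheory.Automorphic Literature.NumberTheory.Automorphic.HermitianLattice
open Literature.NumberTheory.Automorphic.UnitaryLatticeTree Literature.NumberTheory.Automorphic.UnitaryThreeFourFrame
open Summit.HodgeConjecture.HodgeConjecture.Cruxes.H413.F0P3cDyRamDiagonalTorusDefs
open Summit.HodgeConjecture.HodgeConjecture.Cruxes.H413.F0P3cDyRamDiagonalStrataDefs
open Summit.HodgeConjecture.HodgeConjecture.Cruxes.H413.F0P3cDyRamDiagonalStableLatticeHNF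
open Summit.HodgeConjecture.HodgeConjecture.Cruxes.H413.F0P3cDyRamDiagonalStableLatticeHNFExists
open Summit.HodgeConjecture.HodgeConjecture.Cruxes.H413.F0P3cDyRamDiagonalHNFAxisExponents
open Summit.HodgeConjecture.HodgeConjecture.Cruxes.H413.F0P3cDyRamDiagonalDualisableStrata
open Summit.HodgeConjecture.HodgeConjecture.Cruxes.H413.F0P3cDyRamDiagonalStrataAxis
open scoped Valued WithZero Matrix MatrixGroups

/-! ## §1  Order bookkeeping in `ℤᵐ⁰` -/

/-- `a·exp m ≤ exp n ↔ a ≤ exp(n − m)`. [cite: Serre1980Trees, II §1.1] -/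
theorem mul_exp_le_exp_iff (a : ℤᵐ⁰) (m n : ℤ) : a * WithZero.exp m ≤ WithZero.exp n ↔ a ≤ WithZero.exp (n - m) := by
  rw [WithZero.exp_sub, le_div_iff₀ WithZero.exp_pos]

/-- `(a ≤ exp k ∧ a·exp m ≤ exp n) ↔ a ≤ exp r` when `r = n − m ≤ k`. [cite: Serre1980Trees, II §1.1] -/
theorem le_and_mul_exp_le_iff (a : ℤᵐ⁰) {k m n r : ℤ} (hr : r = n - m) (hk : r ≤ k) :
    (a ≤ WithZero.exp k ∧ a * WithZero.exp m ≤ WithZero.exp n) ↔ a ≤ WithZero.exp r := by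
  rw [mul_exp_le_exp_iff, ← hr]
  exact ⟨fun h => h.2, fun h => ⟨h.trans (WithZero.exp_le_exp.2 hk), h⟩⟩

/-- `(a ≤ exp k ∧ a ≤ exp l ∧ a·exp m ≤ exp n) ↔ a ≤ exp r` when `r = n − m ≤ k, l`. [cite: Serre1980Trees, II §1.1] -/
theorem le_and_le_and_mul_exp_le_iff (a : ℤᵐ⁰) {k l m n r : ℤ} (hr : r = n - m) (hk : r ≤ k) (hl : r ≤ l) :
    (a ≤ WithZero.exp k ∧ a ≤ WithZero.exp l ∧ a * WithZero.exp m ≤ WithZero.exp n) ↔ a ≤ WithZero.exp r := by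
  rw [mul_exp_le_exp_iff, ← hr]
  exact ⟨fun h => h.2.2, fun h => ⟨h.trans (WithZero.exp_le_exp.2 hk), h.trans (WithZero.exp_le_exp.2 hl), h⟩⟩

variable {K : Type*} [Field K] [Valued K ℤᵐ⁰]

/-! ## §2  The axis vectors of the eight strata (★ B2's criteria, collapsed) -/

/-- `HasAxis` on `Fin 3` from the three coordinate criteria. [cite: Serre1980Trees, II §1.1] -/
theorem hasAxis_of_three {ϖ : K} {M : Submodule 𝒪[K] (Fin 3 → K)} {a₀ a₁ a₂ : ℕ}
    (h0 : ∀ t : K, (Pi.single (0 : Fin 3) t : Fin 3 → K) ∈ M ↔ Valued.v t ≤ Valued.v ϖ ^ a₀)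
    (h1 : ∀ t : K, (Pi.single (1 : Fin 3) t : Fin 3 → K) ∈ M ↔ Valued.v t ≤ Valued.v ϖ ^ a₁)
    (h2 : ∀ t : K, (Pi.single (2 : Fin 3) t : Fin 3 → K) ∈ M ↔ Valued.v t ≤ Valued.v ϖ ^ a₂) :
    HasAxis ϖ M ![a₀, a₁, a₂] := by
  refine (hasAxis_iff ϖ _ _).2 fun i t => ?_
  fin_cases i
  · exact h0 t
  · exact h1 t
  · exact h2 t

section Strata

variable {ϖ : K} (hϖ : Valued.v ϖ = WithZero.exp (-1 : ℤ))
include hϖ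

/-- (core) `b = c = 0`: axis vector `(0,0,0)`. [cite: Serre1980Trees, II §1.1] [cite: BruhatTits1972, §10] -/
theorem hasAxis_latt_hnf_core {x y z : K} (hx : Valued.v x ≤ 1) (hy : Valued.v y ≤ 1) (hz : Valued.v z ≤ 1) :
    HasAxis ϖ (latt (Matrix.of ![![1, 0, 0], ![x, ϖ ^ 0, 0], ![y, z, ϖ ^ 0]])) ![0, 0, 0] := by
  have hϖ0 : ϖ ≠ 0 := (Valuation.ne_zero_iff Valued.v).1 (by rw [hϖ]; exact WithZero.exp_ne_zero)
  have hw : Valued.v (y * ϖ ^ 0 - x * z) ≤ 1 :=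
    Valuation.map_sub_le _ (by rw [pow_zero, mul_one]; exact hy) (by rw [map_mul]; exact mul_le_one' hx hz)
  refine hasAxis_of_three (fun t => ?_) (fun t => ?_) (fun t => ?_)
  · show _ ↔ Valued.v t ≤ Valued.v ϖ ^ 0
    rw [single_zero_mem_latt_hnf_pow_iff hϖ0, zero_add, pow_zero]
    exact ⟨fun h => h.1, fun h => ⟨h, by rw [map_mul]; exact mul_le_one' h hx, by rw [map_mul]; exact mul_le_one' h hw⟩⟩
  · show _ ↔ Valued.v t ≤ Valued.v ϖ ^ 0
    rw [single_one_mem_latt_hnf_pow_iff hϖ0, zero_add, pow_zero]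
    exact ⟨fun h => h.1, fun h => ⟨h, by rw [map_mul]; exact mul_le_one' h hz⟩⟩
  · show _ ↔ Valued.v t ≤ Valued.v ϖ ^ 0
    rw [single_two_mem_latt_hnf_pow_iff hϖ0]

/-- (T₃ s) `c = 0`, `b = s`, `|x| = 1`: axis vector `(s,s,0)`. [cite: Serre1980Trees, II §1.1] [cite: BruhatTits1972, §10] -/
theorem hasAxis_latt_hnf_T3 (s : ℕ) {x y z : K} (hx1 : Valued.v x = 1) (hy : Valued.v y ≤ 1) (hz : Valued.v z ≤ 1) :
    HasAxis ϖ (latt (Matrix.of ![![1, 0, 0], ![x, ϖ ^ s, 0], ![y, z, ϖ ^ 0]])) ![s, s, 0] := by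
  have hϖ0 : ϖ ≠ 0 := (Valuation.ne_zero_iff Valued.v).1 (by rw [hϖ]; exact WithZero.exp_ne_zero)
  have hq1 : ∀ n : ℕ, Valued.v ϖ ^ n ≤ 1 := fun n => pow_le_one₀ zero_le (by rw [hϖ, ← WithZero.exp_zero, WithZero.exp_le_exp]; omega)
  have hw : Valued.v (y * ϖ ^ s - x * z) ≤ 1 :=
    Valuation.map_sub_le _ (by rw [map_mul, map_pow]; exact mul_le_one' hy (hq1 s)) (by rw [map_mul, hx1, one_mul]; exact hz)
  refine hasAxis_of_three (fun t => ?_) (fun t => ?_) (fun t => ?_)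
  · show _ ↔ Valued.v t ≤ Valued.v ϖ ^ s
    rw [single_zero_mem_latt_hnf_pow_iff hϖ0, add_zero, map_mul, hx1, mul_one]
    exact ⟨fun h => h.2.1, fun h => ⟨h.trans (hq1 s), h, by rw [map_mul]; exact (mul_le_of_le_one_right' hw).trans h⟩⟩
  · show _ ↔ Valued.v t ≤ Valued.v ϖ ^ s
    rw [single_one_mem_latt_hnf_pow_iff hϖ0, add_zero]
    exact ⟨fun h => h.1, fun h => ⟨h, by rw [map_mul]; exact (mul_le_of_le_one_right' hz).trans h⟩⟩
  · show _ ↔ Valued.v t ≤ Valued.v ϖ ^ 0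
    rw [single_two_mem_latt_hnf_pow_iff hϖ0]

/-- (T₂ s) `b = 0`, `c = s ≥ 1`, `|z| ≤ |ϖ|^s`, `|y| = 1`: axis vector `(s,0,s)` (`|y − xz| = 1`). [cite: Serre1980Trees, II §1.1] [cite: BruhatTits1972, §10] -/
theorem hasAxis_latt_hnf_T2 {s : ℕ} (hs : 1 ≤ s) {x y z : K} (hx : Valued.v x ≤ 1) (hzs : Valued.v z ≤ Valued.v (ϖ ^ s)) (hy1 : Valued.v y = 1) :
    HasAxis ϖ (latt (Matrix.of ![![1, 0, 0], ![x, ϖ ^ 0, 0], ![y, z, ϖ ^ s]])) ![s, 0, s] := by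
  have hϖ0 : ϖ ≠ 0 := (Valuation.ne_zero_iff Valued.v).1 (by rw [hϖ]; exact WithZero.exp_ne_zero)
  have hqs : Valued.v ϖ ^ s < 1 := by
    rw [hϖ, ← WithZero.exp_nsmul, ← WithZero.exp_zero, WithZero.exp_lt_exp]; simp; omega
  have hqs1 : Valued.v ϖ ^ s ≤ 1 := hqs.le
  rw [map_pow] at hzs
  have hw : Valued.v (y * ϖ ^ 0 - x * z) = 1 := by
    rw [pow_zero, mul_one, Valuation.map_sub_swap, Valuation.map_sub_eq_of_lt_right _ ?_]
    · exact hy1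
    · rw [hy1, map_mul]
      exact lt_of_le_of_lt (mul_le_of_le_one_left' hx) (lt_of_le_of_lt hzs hqs)
  refine hasAxis_of_three (fun t => ?_) (fun t => ?_) (fun t => ?_)
  · show _ ↔ Valued.v t ≤ Valued.v ϖ ^ s
    rw [single_zero_mem_latt_hnf_pow_iff hϖ0, zero_add]
    constructor
    · rintro ⟨-, -, h⟩
      rwa [map_mul, hw, mul_one] at h
    · intro h
      refine ⟨h.trans hqs1, ?_, ?_⟩
      · rw [map_mul, pow_zero]; exact mul_le_one' (h.trans hqs1) hx
      · rwa [map_mul, hw, mul_one]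
  · show _ ↔ Valued.v t ≤ Valued.v ϖ ^ 0
    rw [single_one_mem_latt_hnf_pow_iff hϖ0, zero_add, pow_zero]
    exact ⟨fun h => h.1, fun h => ⟨h, by rw [map_mul]; exact (mul_le_of_le_one_left' h).trans hzs⟩⟩
  · show _ ↔ Valued.v t ≤ Valued.v ϖ ^ s
    rw [single_two_mem_latt_hnf_pow_iff hϖ0]

/-- (T₁ s) `b = 0`, `c = s`, `|z| = 1`, `|y − xz| ≤ |ϖ|^s`: axis vector `(0,s,s)`. [cite: Serre1980Trees, II §1.1] [cite: BruhatTits1972, §10] -/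
theorem hasAxis_latt_hnf_T1 (s : ℕ) {x y z : K} (hx : Valued.v x ≤ 1) (hz1 : Valued.v z = 1) (hw : Valued.v (y - x * z) ≤ Valued.v (ϖ ^ s)) :
    HasAxis ϖ (latt (Matrix.of ![![1, 0, 0], ![x, ϖ ^ 0, 0], ![y, z, ϖ ^ s]])) ![0, s, s] := by
  have hϖ0 : ϖ ≠ 0 := (Valuation.ne_zero_iff Valued.v).1 (by rw [hϖ]; exact WithZero.exp_ne_zero)
  have hqs1 : Valued.v ϖ ^ s ≤ 1 := pow_le_one₀ zero_le (by rw [hϖ, ← WithZero.exp_zero, WithZero.exp_le_exp]; omega)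
  rw [map_pow] at hw
  refine hasAxis_of_three (fun t => ?_) (fun t => ?_) (fun t => ?_)
  · show _ ↔ Valued.v t ≤ Valued.v ϖ ^ 0
    rw [single_zero_mem_latt_hnf_pow_iff hϖ0, zero_add, pow_zero, pow_zero, mul_one]
    exact ⟨fun h => h.1, fun h => ⟨h, by rw [map_mul]; exact mul_le_one' h hx, by rw [map_mul]; exact (mul_le_of_le_one_left' h).trans hw⟩⟩
  · show _ ↔ Valued.v t ≤ Valued.v ϖ ^ s
    rw [single_one_mem_latt_hnf_pow_iff hϖ0, zero_add, pow_zero, map_mul, hz1, mul_one]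
    exact ⟨fun h => h.2, fun h => ⟨h.trans hqs1, h⟩⟩
  · show _ ↔ Valued.v t ≤ Valued.v ϖ ^ s
    rw [single_two_mem_latt_hnf_pow_iff hϖ0]

/-- (G₁ ρ s) `b = ρ`, `c = 2ρ+s`, `|z| = |ϖ|^ρ`, `|x| = 1`, `|yϖ^ρ − xz| = |ϖ|^{ρ+s}`: axis vector `(2ρ, 2ρ+s, 2ρ+s)`. [cite: Serre1980Trees, II §1.1] [cite: BruhatTits1972, §10] -/
theorem hasAxis_latt_hnf_G1 (ρ s : ℕ) {x y z : K} (hx1 : Valued.v x = 1) (hzρ : Valued.v z = Valued.v (ϖ ^ ρ))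
    (hw : Valued.v (y * ϖ ^ ρ - x * z) = Valued.v (ϖ ^ (ρ + s))) :
    HasAxis ϖ (latt (Matrix.of ![![1, 0, 0], ![x, ϖ ^ ρ, 0], ![y, z, ϖ ^ (2 * ρ + s)]])) ![2 * ρ, 2 * ρ + s, 2 * ρ + s] := by
  have hϖ0 : ϖ ≠ 0 := (Valuation.ne_zero_iff Valued.v).1 (by rw [hϖ]; exact WithZero.exp_ne_zero)
  have hq : ∀ n : ℕ, Valued.v ϖ ^ n = WithZero.exp (-(n : ℤ)) := fun n => by
    rw [hϖ, ← WithZero.exp_nsmul]; congr 1; simp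
  rw [map_pow, hq] at hzρ hw
  refine hasAxis_of_three (fun t => ?_) (fun t => ?_) (fun t => ?_)
  · show _ ↔ Valued.v t ≤ Valued.v ϖ ^ (2 * ρ)
    rw [single_zero_mem_latt_hnf_pow_iff hϖ0, map_mul, hx1, mul_one, map_mul, hw, ← WithZero.exp_zero, hq, hq, hq]
    exact le_and_le_and_mul_exp_le_iff _ (by push_cast; ring) (by omega) (by omega)
  · show _ ↔ Valued.v t ≤ Valued.v ϖ ^ (2 * ρ + s)
    rw [single_one_mem_latt_hnf_pow_iff hϖ0, map_mul, hzρ, hq, hq, hq]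
    exact le_and_mul_exp_le_iff _ (by push_cast; ring) (by omega)
  · show _ ↔ Valued.v t ≤ Valued.v ϖ ^ (2 * ρ + s)
    rw [single_two_mem_latt_hnf_pow_iff hϖ0]

/-- (G₂ ρ s) `b = ρ`, `c = 2ρ+s` (`s ≥ 1`), `|z| = |ϖ|^{ρ+s}`, `|x| = |y| = 1`: axis vector `(2ρ+s, 2ρ, 2ρ+s)` (`|yϖ^ρ − xz| = |ϖ|^ρ`). [cite: Serre1980Trees, II §1.1]
[cite: BruhatTits1972, §10] -/
theorem hasAxis_latt_hnf_G2 (ρ : ℕ) {s : ℕ} (hs : 1 ≤ s) {x y z : K} (hx1 : Valued.v x = 1) (hy1 : Valued.v y = 1) (hzρ : Valued.v z = Valued.v (ϖ ^ (ρ + s))) :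
    HasAxis ϖ (latt (Matrix.of ![![1, 0, 0], ![x, ϖ ^ ρ, 0], ![y, z, ϖ ^ (2 * ρ + s)]])) ![2 * ρ + s, 2 * ρ, 2 * ρ + s] := by
  have hϖ0 : ϖ ≠ 0 := (Valuation.ne_zero_iff Valued.v).1 (by rw [hϖ]; exact WithZero.exp_ne_zero)
  have hq : ∀ n : ℕ, Valued.v ϖ ^ n = WithZero.exp (-(n : ℤ)) := fun n => by
    rw [hϖ, ← WithZero.exp_nsmul]; congr 1; simp
  rw [map_pow, hq] at hzρ
  have hw : Valued.v (y * ϖ ^ ρ - x * z) = WithZero.exp (-(ρ : ℤ)) := by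
    rw [Valuation.map_sub_eq_of_lt_left _ ?_]
    · rw [map_mul, hy1, one_mul, map_pow, hq]
    · rw [map_mul, hx1, one_mul, hzρ, map_mul, hy1, one_mul, map_pow, hq, WithZero.exp_lt_exp]; omega
  refine hasAxis_of_three (fun t => ?_) (fun t => ?_) (fun t => ?_)
  · show _ ↔ Valued.v t ≤ Valued.v ϖ ^ (2 * ρ + s)
    rw [single_zero_mem_latt_hnf_pow_iff hϖ0, map_mul, hx1, mul_one, map_mul, hw, ← WithZero.exp_zero, hq, hq, hq]
    exact le_and_le_and_mul_exp_le_iff _ (by push_cast; ring) (by omega) (by omega)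
  · show _ ↔ Valued.v t ≤ Valued.v ϖ ^ (2 * ρ)
    rw [single_one_mem_latt_hnf_pow_iff hϖ0, map_mul, hzρ, hq, hq, hq]
    exact le_and_mul_exp_le_iff _ (by push_cast; ring) (by omega)
  · show _ ↔ Valued.v t ≤ Valued.v ϖ ^ (2 * ρ + s)
    rw [single_two_mem_latt_hnf_pow_iff hϖ0]

/-- (G₃ ρ s) `c = 2ρ`, `b = ρ+s` (`s ≥ 1`), `|z| = |ϖ|^ρ`, `|x| = |y| = 1`: axis vector `(2ρ+s, 2ρ+s, 2ρ)` (`|yϖ^{ρ+s} − xz| = |ϖ|^ρ`). [cite: Serre1980Trees, II §1.1]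
[cite: BruhatTits1972, §10] -/
theorem hasAxis_latt_hnf_G3 (ρ : ℕ) {s : ℕ} (hs : 1 ≤ s) {x y z : K} (hx1 : Valued.v x = 1) (hy1 : Valued.v y = 1) (hzρ : Valued.v z = Valued.v (ϖ ^ ρ)) :
    HasAxis ϖ (latt (Matrix.of ![![1, 0, 0], ![x, ϖ ^ (ρ + s), 0], ![y, z, ϖ ^ (2 * ρ)]])) ![2 * ρ + s, 2 * ρ + s, 2 * ρ] := by
  have hϖ0 : ϖ ≠ 0 := (Valuation.ne_zero_iff Valued.v).1 (by rw [hϖ]; exact WithZero.exp_ne_zero)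
  have hq : ∀ n : ℕ, Valued.v ϖ ^ n = WithZero.exp (-(n : ℤ)) := fun n => by
    rw [hϖ, ← WithZero.exp_nsmul]; congr 1; simp
  rw [map_pow, hq] at hzρ
  have hw : Valued.v (y * ϖ ^ (ρ + s) - x * z) = WithZero.exp (-(ρ : ℤ)) := by
    rw [Valuation.map_sub_eq_of_lt_right _ ?_]
    · rw [map_mul, hx1, one_mul, hzρ]
    · rw [map_mul, map_mul, hx1, hy1, one_mul, one_mul, hzρ, map_pow, hq, WithZero.exp_lt_exp]; push_cast; omega
  refine hasAxis_of_three (fun t => ?_) (fun t => ?_) (fun t => ?_)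
  · show _ ↔ Valued.v t ≤ Valued.v ϖ ^ (2 * ρ + s)
    rw [single_zero_mem_latt_hnf_pow_iff hϖ0, map_mul, hx1, mul_one, map_mul, hw, ← WithZero.exp_zero, hq, hq, hq]
    exact le_and_le_and_mul_exp_le_iff _ (by push_cast; ring) (by omega) (by omega)
  · show _ ↔ Valued.v t ≤ Valued.v ϖ ^ (2 * ρ + s)
    rw [single_one_mem_latt_hnf_pow_iff hϖ0, map_mul, hzρ, hq, hq, hq]
    exact le_and_mul_exp_le_iff _ (by push_cast; ring) (by omega)
  · show _ ↔ Valued.v t ≤ Valued.v ϖ ^ (2 * ρ)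
    rw [single_two_mem_latt_hnf_pow_iff hϖ0]

/-- (H ρ) `b = ρ`, `c = 2ρ`, `|z| = |ϖ|^ρ`, `|x| = 1`, `|yϖ^ρ − xz| = |ϖ|^ρ`: axis vector `(2ρ, 2ρ, 2ρ)`. [cite: Serre1980Trees, II §1.1] [cite: BruhatTits1972, §10] -/
theorem hasAxis_latt_hnf_H (ρ : ℕ) {x y z : K} (hx1 : Valued.v x = 1) (hzρ : Valued.v z = Valued.v (ϖ ^ ρ))
    (hw : Valued.v (y * ϖ ^ ρ - x * z) = Valued.v (ϖ ^ ρ)) :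
    HasAxis ϖ (latt (Matrix.of ![![1, 0, 0], ![x, ϖ ^ ρ, 0], ![y, z, ϖ ^ (2 * ρ)]])) ![2 * ρ, 2 * ρ, 2 * ρ] := by
  have hϖ0 : ϖ ≠ 0 := (Valuation.ne_zero_iff Valued.v).1 (by rw [hϖ]; exact WithZero.exp_ne_zero)
  have hq : ∀ n : ℕ, Valued.v ϖ ^ n = WithZero.exp (-(n : ℤ)) := fun n => by
    rw [hϖ, ← WithZero.exp_nsmul]; congr 1; simp
  rw [map_pow, hq] at hzρ hw
  refine hasAxis_of_three (fun t => ?_) (fun t => ?_) (fun t => ?_)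
  · show _ ↔ Valued.v t ≤ Valued.v ϖ ^ (2 * ρ)
    rw [single_zero_mem_latt_hnf_pow_iff hϖ0, map_mul, hx1, mul_one, map_mul, hw, ← WithZero.exp_zero, hq, hq, hq]
    exact le_and_le_and_mul_exp_le_iff _ (by push_cast; ring) (by omega) (by omega)
  · show _ ↔ Valued.v t ≤ Valued.v ϖ ^ (2 * ρ)
    rw [single_one_mem_latt_hnf_pow_iff hϖ0, map_mul, hzρ, hq, hq, hq]
    exact le_and_mul_exp_le_iff _ (by push_cast; ring) (by omega)
  · show _ ↔ Valued.v t ≤ Valued.v ϖ ^ (2 * ρ)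
    rw [single_two_mem_latt_hnf_pow_iff hϖ0]

end Strata

/-! ## §3  HEAD — B3-γ: the shape list in axis currency -/

/-- **B3-γ · THE SHAPE LIST** (B10 skeleton `stub_B3_shapes`).  Under the ramified quadratic datum (`σ` valuation-preserving with even valuations on its fixed points,
`|ϖ| = exp(−1)`): if `M ∈ 𝓛₀(T)` (a normalised `T`-stable lattice — `T` arbitrary) is DUALISABLE and has axis vector `a`, then `a = (0,0,0)`, or `a ∈ {(0,s,s), (s,0,s), (s,s,0)}`
with `s ≥ 2` even, or `a ∈ {(2ρ, 2ρ+s, 2ρ+s), (2ρ+s, 2ρ, 2ρ+s), (2ρ+s, 2ρ+s, 2ρ)}` with `ρ ≥ 1`, `s ≥ 2` even, or `a = (2ρ, 2ρ, 2ρ)` with `ρ ≥ 1` — HNF model (★ `exists_latt_eq_latt_hnf`),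
the strata table (part 2 `dualisable_strata`), the stratum's axis vector (§2), uniqueness (part 3 `hasAxis_unique`). [cite: Kottwitz1986BaseChangeUnits, §1 pp. 240–241]
[cite: Serre1980Trees, II §1.1] [cite: BruhatTits1972, §10] -/
theorem hasAxis_shapes {K : Type} [Field K] [Valued K ℤᵐ⁰] {σ : K →+* K} {ϖ : K} {d t : ℕ} {T : GL (Fin 3) K}
    (hD : IsRamifiedQuadraticDatum σ ϖ d t) {M : Submodule 𝒪[K] (Fin 3 → K)} {a : Fin 3 → ℕ}
    (hM : M ∈ normalisedStableLattices T) (hdual : IsDualisableLattice σ ϖ M) (ha : HasAxis ϖ M a) :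
    (a = ![0, 0, 0]) ∨
    (∃ s, 2 ∣ s ∧ 2 ≤ s ∧ (a = ![0, s, s] ∨ a = ![s, 0, s] ∨ a = ![s, s, 0])) ∨
    (∃ ρ s, 1 ≤ ρ ∧ 2 ∣ s ∧ 2 ≤ s ∧ (a = ![2 * ρ, 2 * ρ + s, 2 * ρ + s] ∨ a = ![2 * ρ + s, 2 * ρ, 2 * ρ + s] ∨ a = ![2 * ρ + s, 2 * ρ + s, 2 * ρ])) ∨
    (∃ ρ, 1 ≤ ρ ∧ a = ![2 * ρ, 2 * ρ, 2 * ρ]) := by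
  obtain ⟨-, hvσ, hϖ, hfix, -⟩ := hD
  obtain ⟨⟨g, rfl⟩, -, hnorm⟩ := hM
  have hq1 : ∀ n : ℕ, Valued.v (ϖ ^ n) ≤ 1 := fun n => by
    rw [map_pow]; exact pow_le_one₀ zero_le (by rw [hϖ, ← WithZero.exp_zero, WithZero.exp_le_exp]; omega)
  have hq_eq_one : ∀ n : ℕ, Valued.v (ϖ ^ n) = 1 → n = 0 := fun n h => by
    rw [map_pow, hϖ, ← WithZero.exp_nsmul, ← WithZero.exp_zero, WithZero.exp_inj] at h
    simp at h
    omega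
  -- the HNF model of the normalised lattice `latt g ⊆ 𝒪³`
  have hle : latt (g : Matrix (Fin 3) (Fin 3) K) ≤ stdLattice K 3 := fun w hw => mem_stdLattice.2 fun i => (hnorm i).1 w hw
  obtain ⟨b, c, x, y, z, hx, hy, hz, hV⟩ := exists_latt_eq_latt_hnf hϖ g hle (hnorm 0).2
  rw [hV] at hnorm hdual ha
  have hN := (normalised_latt_hnf_iff hx hy hz (hq1 b) (hq1 c)).1 hnorm
  have hxb : 1 ≤ b → Valued.v x = 1 := fun hb => hN.1.resolve_left fun h => by have := hq_eq_one b h; omega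
  -- the table, stratum by stratum
  rcases dualisable_strata hvσ hfix hϖ b c hx hy hz hnorm hdual with
    ⟨hb, hc⟩ | ⟨s, hc, hb, h2s, hs2⟩ | ⟨s, hb, hc, h2s, hs2, hzs, hy1⟩ | ⟨s, hb, hc, h2s, hs2, hz1, hw⟩ |
    ⟨ρ, s, hρ, hs2, h2s, hb, hc, hzρ, hy1, hw⟩ | ⟨ρ, s, hρ, hs2, h2s, hb, hc, hzρ, hy1⟩ | ⟨ρ, s, hρ, hs2, h2s, hc, hb, hzρ, hy1⟩ | ⟨ρ, hρ, hb, hc, hzρ, hy1, hw⟩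
  · subst b; subst c
    exact Or.inl (hasAxis_unique hϖ ha (hasAxis_latt_hnf_core hϖ hx hy hz))
  · subst b; subst c
    exact Or.inr (Or.inl ⟨s, h2s, hs2, Or.inr (Or.inr (hasAxis_unique hϖ ha (hasAxis_latt_hnf_T3 hϖ s (hxb (by omega)) hy hz)))⟩)
  · subst b; subst c
    exact Or.inr (Or.inl ⟨s, h2s, hs2, Or.inr (Or.inl (hasAxis_unique hϖ ha (hasAxis_latt_hnf_T2 hϖ (by omega) hx hzs hy1)))⟩)
  · subst b; subst c
    exact Or.inr (Or.inl ⟨s, h2s, hs2, Or.inl (hasAxis_unique hϖ ha (hasAxis_latt_hnf_T1 hϖ s hx hz1 hw))⟩)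
  · subst b; subst c
    exact Or.inr (Or.inr (Or.inl ⟨ρ, s, hρ, h2s, hs2, Or.inl (hasAxis_unique hϖ ha (hasAxis_latt_hnf_G1 hϖ ρ s (hxb hρ) hzρ hw))⟩))
  · subst b; subst c
    exact Or.inr (Or.inr (Or.inl ⟨ρ, s, hρ, h2s, hs2, Or.inr (Or.inl (hasAxis_unique hϖ ha (hasAxis_latt_hnf_G2 hϖ ρ (by omega) (hxb hρ) hy1 hzρ)))⟩))
  · subst b; subst c
    exact Or.inr (Or.inr (Or.inl ⟨ρ, s, hρ, h2s, hs2, Or.inr (Or.inr (hasAxis_unique hϖ ha (hasAxis_latt_hnf_G3 hϖ ρ (by omega) (hxb (by omega)) hy1 hzρ)))⟩))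
  · subst b; subst c
    exact Or.inr (Or.inr (Or.inr ⟨ρ, hρ, hasAxis_unique hϖ ha (hasAxis_latt_hnf_H hϖ ρ (hxb hρ) hzρ hw)⟩))

end Summit.HodgeConjecture.HodgeConjecture.Cruxes.H413.F0P3cDyRamDiagonalStrataShapes

end
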